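import Summits.Ventures.LatticeQCDFlow.Scaling.ExchangeOfferCeiling
import Summits.Ventures.LatticeQCDFlow.Scaling.TemperingLikelihoodRatio

/-!
HONEST FRAMING: exact (Metropolis-corrected) sampling algorithms for lattice gauge theory; figures
of merit are autocorrelation/cost numbers at stated couplings and volumes; no continuum-physics
claim.

# BoltzmannHubLaw — FOR A TEMPERING FAMILY `μ_k ∝ w·e^{β_k X}` (`β_0 ≤ β_k`, `X` MAXIMAL AT A GROUND STATE `u₀`) THE
# ONE-SIDED DOMINATION CONSTANT IS THE GROUND-STATE RATIO `μ_0(u₀)/μ_k(u₀)` (= `Z_k/Z_0` WHEN `X(u₀) = 0`), SO THE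
# HOT-ONLY HUB OBEYS `p·min{t, γ₀(1−t)}/(14K) ≤ Gap ≤ 2t·(μ_0(u₀)/μ_{k+1}(u₀))/K` WITH `p = min_k μ_0(u₀)/μ_{k+1}(u₀)`:
# THE PARTITION-FUNCTION RATIO IS THE RATE (lean-2 GEN-22, ours)

Venture-side (OURS).  Cell `lqcd-flow` (pub-lqcd), unit `pub-lqcd-lean-2-g22`, 2026-08-26.  Chapter J, file 12:
`Scaling/OneSidedHubFloor` (J8: `Gap ≥ p·min{t,γ₀(1−t)}/(14K)` under `p·μ_{k+1} ≤ μ_0`) and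
`Scaling/ExchangeOfferCeiling` (J10: `Gap ≤ 2t·(μ_0(u)/μ_{k+1}(u))/K`) read for the exponential family of
`Scaling/TemperingLikelihoodRatio` (hypothesis form `μ_k(x) = w(x)e^{β_k X(x)}/Σ_y w(y)e^{β_k X(y)}`, no new
definitions; think `X = −`action, `β_0` the hottest coupling).  If `β_0 ≤ β_k` and `X` attains its maximum at `u₀`,
the likelihood ratio `μ_k/μ_0 = e^{(β_k−β_0)X}·Z_0/Z_k` is largest at `u₀`: the hot law dominates every cold law
pointwise with the constant `μ_0(u₀)/μ_k(u₀)` and with no better constant, and that same number is J10's ceiling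
ratio at `u₀`.  With `X(u₀) = 0` it is the partition-function ratio `Z_k/Z_0 = Σ_y w(y)e^{β_kX(y)}/Σ_y w(y)e^{β_0X(y)}`.

## What is proved

* §1 **`expFamily_domination_groundState`** (`(μ_0(u₀)/μ_k(u₀))·μ_k(x) ≤ μ_0(x)` for `β_0 ≤ β_k`, `X ≤ X(u₀)`),
  `expFamily_domination_sharp` (no constant `> μ_0(u₀)/μ_k(u₀)` dominates), **`expFamily_groundStateRatio_eq`**
  (`X(u₀) = 0 ⇒ μ_0(u₀)/μ_k(u₀) = Z_k/Z_0`).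
* §2 **`boltzmannHub_spectralGap_two_sided`** — hot-only star, identity maps, hot update with Poincaré constant `γ₀`,
  `0 < t < 1`, `K ≥ 1`, `p·μ_{k+1}(u₀) ≤ μ_0(u₀)` for all cold levels (`0 < p ≤ 1`):
  `p·min{t, γ₀(1−t)}/(14K) ≤ Gap`, and `Gap ≤ 2t·(μ_0(u₀)/μ_{k+1}(u₀))/K` for every `k` with `μ_{k+1}(u₀) ≤ ½`;
  **`boltzmannHub_spectralGap_two_sided_Z`** — the same with `Z_{k+1}/Z_0` when `X(u₀) = 0`.

Reading (no numerics implied): over a ladder of couplings a map-less hub relaxes, per replica, at the rate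
`Z_cold/Z_hot` — for an extensive action exponentially small in (coupling gap) × (volume): the exact statement of why
direct hot–cold exchange needs transport maps, and (J8/J9) of what the maps restore — the constant becomes the
one-sided persistence of the SECTOR weights.  NOT CLAIMED: anything about ladders of couplings with adjacent swaps
(chapters R/Y); continuous configuration spaces; anything measured.  Literature grade (cell rule): ELEMENTARY
COROLLARIES; nothing cited as a fact; no new bib keys.
-/

noncomputable section

open Finset Function Real
open Literature.Probability.MarkovChains

namespace Summit.Ventures.LatticeQCDFlow.Scaling

section Boltzmann

variable {S : Type*} [Fintype S] [DecidableEq S] {K : ℕ} {μ : Fin (K + 1) → S → ℝ}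
  {M : Fin (K + 1) → S → S → ℝ} {t : ℝ} {w X : S → ℝ} (hw : ∀ x, 0 < w x) {β : Fin (K + 1) → ℝ}
  (hμZ : ∀ k x, μ k x = w x * exp (β k * X x) / ∑ y, w y * exp (β k * X y))
include hw hμZ

/-! ## §1 The domination constant of the exponential family is the ground-state ratio -/

omit [DecidableEq S] hμZ in
/-- Partition functions are positive. [ours] -/
theorem expFamily_Z_pos [Nonempty S] (k : Fin (K + 1)) : 0 < ∑ y, w y * exp (β k * X y) :=
  Finset.sum_pos (fun y _ => mul_pos (hw y) (exp_pos _)) univ_nonempty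

omit [DecidableEq S] in
/-- **THE HOT LAW DOMINATES EVERY COLDER MEMBER WITH THE GROUND-STATE RATIO:** if `β_0 ≤ β_k` and `X(x) ≤ X(u₀)` for
all `x`, then `(μ_0(u₀)/μ_k(u₀))·μ_k(x) ≤ μ_0(x)` for all `x`. [ours] -/
theorem expFamily_domination_groundState {u₀ : S} (hX : ∀ x, X x ≤ X u₀) (k : Fin (K + 1)) (hβ : β 0 ≤ β k) (x : S) :
    μ 0 u₀ / μ k u₀ * μ k x ≤ μ 0 x := by
  have hpos : ∀ l y, 0 < μ l y := fun l y => expFamily_pos hw hμZ l y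
  rw [div_mul_eq_mul_div, div_le_iff₀ (hpos k u₀)]
  -- `μ_0(u₀)μ_k(x) ≤ μ_0(x)μ_k(u₀)`: cross-multiplied, `e^{β_0X(u₀)+β_kX(x)} ≤ e^{β_0X(x)+β_kX(u₀)}`
  haveI : Nonempty S := ⟨x⟩
  have hZ0 := expFamily_Z_pos (β := β) (X := X) hw 0
  have hZk := expFamily_Z_pos (β := β) (X := X) hw k
  rw [hμZ 0 u₀, hμZ k x, hμZ 0 x, hμZ k u₀]
  rw [div_mul_div_comm, div_mul_div_comm, div_le_div_iff₀ (mul_pos hZ0 hZk) (mul_pos hZ0 hZk)]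
  have hexp : exp (β 0 * X u₀) * exp (β k * X x) ≤ exp (β 0 * X x) * exp (β k * X u₀) := by
    rw [← exp_add, ← exp_add, exp_le_exp]
    nlinarith [hX x]
  have hww : 0 ≤ w u₀ * w x := (mul_pos (hw u₀) (hw x)).le
  calc w u₀ * exp (β 0 * X u₀) * (w x * exp (β k * X x)) * ((∑ y, w y * exp (β 0 * X y)) * ∑ y, w y * exp (β k * X y))
      = (w u₀ * w x) * (exp (β 0 * X u₀) * exp (β k * X x))
          * ((∑ y, w y * exp (β 0 * X y)) * ∑ y, w y * exp (β k * X y)) := by ring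
    _ ≤ (w u₀ * w x) * (exp (β 0 * X x) * exp (β k * X u₀))
          * ((∑ y, w y * exp (β 0 * X y)) * ∑ y, w y * exp (β k * X y)) :=
        mul_le_mul_of_nonneg_right (mul_le_mul_of_nonneg_left hexp hww) (mul_pos hZ0 hZk).le
    _ = w x * exp (β 0 * X x) * (w u₀ * exp (β k * X u₀))
          * ((∑ y, w y * exp (β 0 * X y)) * ∑ y, w y * exp (β k * X y)) := by ring

omit [DecidableEq S] in
/-- **… and no larger constant does:** `p·μ_k ≤ μ_0` pointwise forces `p ≤ μ_0(u₀)/μ_k(u₀)`. [ours] -/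
theorem expFamily_domination_sharp {u₀ : S} (k : Fin (K + 1)) {p : ℝ} (hdom : ∀ x, p * μ k x ≤ μ 0 x) :
    p ≤ μ 0 u₀ / μ k u₀ := by
  rw [le_div_iff₀ (expFamily_pos hw hμZ k u₀)]
  exact hdom u₀

omit [DecidableEq S] in
/-- **`X(u₀) = 0 ⇒ μ_0(u₀)/μ_k(u₀) = Z_k/Z_0`**, `Z_l = Σ_y w(y)e^{β_l X(y)}`. [ours] -/
theorem expFamily_groundStateRatio_eq {u₀ : S} (hX0 : X u₀ = 0) (k : Fin (K + 1)) :
    μ 0 u₀ / μ k u₀ = (∑ y, w y * exp (β k * X y)) / ∑ y, w y * exp (β 0 * X y) := by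
  haveI : Nonempty S := ⟨u₀⟩
  have hZ0 := expFamily_Z_pos (β := β) (X := X) hw 0
  have hZk := expFamily_Z_pos (β := β) (X := X) hw k
  rw [hμZ 0 u₀, hμZ k u₀, hX0, mul_zero, mul_zero, exp_zero, mul_one]
  have hw0 : w u₀ ≠ 0 := (hw u₀).ne'
  field_simp

/-! ## §2 The hot-only hub over a tempering family: the partition-function ratio is the rate -/

/-- **THE BOLTZMANN HUB LAW:** hot-only star with identity maps over the family (`β_0 ≤ β_{k+1}`, `X ≤ X(u₀)`), hot
update with Poincaré constant `γ₀`, `0 < t < 1`, `K ≥ 1`, `|S| ≥ 2`, and `0 < p ≤ 1` with `p·μ_{k+1}(u₀) ≤ μ_0(u₀)` for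
every cold level: **`p·min{t, γ₀(1−t)}/(14K) ≤ Gap`, and `Gap ≤ 2t·(μ_0(u₀)/μ_{k+1}(u₀))/K` for every `k` with
`μ_{k+1}(u₀) ≤ ½`.** [ours] -/
theorem boltzmannHub_spectralGap_two_sided [Nontrivial S] (hK : 1 ≤ K) {u₀ : S} (hX : ∀ x, X x ≤ X u₀)
    (hβ : ∀ k : Fin K, β 0 ≤ β k.succ) (hM : ∀ k, IsRowStochastic (M k)) (hMrev : ∀ k, DetailedBalance (μ k) (M k))
    (ht0 : 0 < t) (ht1 : t < 1) {p γ₀ : ℝ} (hp : 0 < p) (hp1 : p ≤ 1) (hγ₀ : 0 < γ₀)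
    (hpu : ∀ k : Fin K, p * μ k.succ u₀ ≤ μ 0 u₀)
    (hgap0 : ∀ h : S → ℝ, γ₀ * lawVariance (μ 0) h ≤ dirichletForm (μ 0) (M 0) h) :
    p * min t (γ₀ * (1 - t)) / (14 * K)
        ≤ spectralGap (tensorFun μ) (fun x y : Fin (K + 1) → S =>
            t * ptGraphSwap μ (fun k : Fin K => ((0 : Fin (K + 1)), k.succ)) (fun _ : Fin K => Equiv.refl S) x y
              + (1 - t) * prodKernel (fun k : Fin (K + 1) => if k = 0 then (1 : ℝ) else 0) M x y)
      ∧ ∀ k : Fin K, μ k.succ u₀ ≤ 1 / 2 →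
        spectralGap (tensorFun μ) (fun x y : Fin (K + 1) → S =>
            t * ptGraphSwap μ (fun k : Fin K => ((0 : Fin (K + 1)), k.succ)) (fun _ : Fin K => Equiv.refl S) x y
              + (1 - t) * prodKernel (fun k : Fin (K + 1) => if k = 0 then (1 : ℝ) else 0) M x y)
          ≤ 2 * t * (μ 0 u₀ / μ k.succ u₀) / K := by
  have hpos : ∀ l y, 0 < μ l y := fun l y => expFamily_pos hw hμZ l y
  have hsum : ∀ l, ∑ y, μ l y = 1 := by
    intro l
    haveI : Nonempty S := inferInstance
    have hZ := expFamily_Z_pos (β := β) (X := X) hw l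
    simp_rw [hμZ l]
    rw [← sum_div, div_self hZ.ne']
  -- the domination `p·μ_{k+1} ≤ μ_0` from the ground-state ratio
  have hdom : ∀ (k : Fin K) (x : S), p * μ k.succ x ≤ μ 0 x := by
    intro k x
    have hratio := expFamily_domination_groundState hw hμZ hX k.succ (hβ k) x
    have hple : p ≤ μ 0 u₀ / μ k.succ u₀ := by rw [le_div_iff₀ (hpos _ _)]; exact hpu k
    calc p * μ k.succ x ≤ μ 0 u₀ / μ k.succ u₀ * μ k.succ x := mul_le_mul_of_nonneg_right hple (hpos _ _).le
      _ ≤ μ 0 x := hratio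
  have hKr : (1 : ℝ) ≤ K := by exact_mod_cast hK
  have hw0 : ∀ k : Fin (K + 1), 0 ≤ (if k = 0 then (1 : ℝ) else 0) := fun k => by positivity
  refine ⟨?_, fun k hk =>
    (oneSidedHotOnlyStar_twoSided_domination (M := M) hK hpos hsum hM hMrev ht0 ht1 hp hp1 hγ₀ hdom hgap0 k hk).2⟩
  have h := oneSidedHub_spectralGap_ge (e := fun k : Fin K => ((0 : Fin (K + 1)), k.succ))
    (w := fun k : Fin (K + 1) => if k = 0 then (1 : ℝ) else 0) hK hK (fun k => (Fin.succ_ne_zero k).symm)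
    (fun k => ⟨k, rfl⟩) hpos hsum hM hMrev hw0 hotOnlyWeight_sum (by simp) ht0 ht1 hp hp1 hγ₀ hdom hgap0
  simp only [if_true, mul_one] at h
  refine le_trans ?_ h
  rw [show p * min t (γ₀ * (1 - t)) / (14 * K) = p * (min t (γ₀ * (1 - t)) / (14 * K)) by ring]
  refine mul_le_mul_of_nonneg_left (le_min ?_ ?_) hp.le
  · calc min t (γ₀ * (1 - t)) / (14 * K) ≤ t / (14 * K) :=
          div_le_div_of_nonneg_right (min_le_left _ _) (by positivity)
      _ ≤ t / (6 * K) := div_le_div_of_nonneg_left ht0.le (by positivity) (by nlinarith)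
  · exact div_le_div_of_nonneg_right (min_le_right _ _) (by positivity)

/-- **THE SAME WITH PARTITION FUNCTIONS:** if moreover `X(u₀) = 0`, the ceiling reads
`Gap ≤ 2t·(Z_{k+1}/Z_0)/K` and the domination hypothesis `p·Z_0 ≤ Z_{k+1}` — the partition-function ratio is the
rate. [ours] -/
theorem boltzmannHub_spectralGap_two_sided_Z [Nontrivial S] (hK : 1 ≤ K) {u₀ : S} (hX : ∀ x, X x ≤ X u₀)
    (hX0 : X u₀ = 0) (hβ : ∀ k : Fin K, β 0 ≤ β k.succ) (hM : ∀ k, IsRowStochastic (M k))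
    (hMrev : ∀ k, DetailedBalance (μ k) (M k)) (ht0 : 0 < t) (ht1 : t < 1) {p γ₀ : ℝ} (hp : 0 < p) (hp1 : p ≤ 1)
    (hγ₀ : 0 < γ₀)
    (hpZ : ∀ k : Fin K, p * ∑ y, w y * exp (β 0 * X y) ≤ ∑ y, w y * exp (β k.succ * X y))
    (hgap0 : ∀ h : S → ℝ, γ₀ * lawVariance (μ 0) h ≤ dirichletForm (μ 0) (M 0) h) :
    p * min t (γ₀ * (1 - t)) / (14 * K)
        ≤ spectralGap (tensorFun μ) (fun x y : Fin (K + 1) → S =>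
            t * ptGraphSwap μ (fun k : Fin K => ((0 : Fin (K + 1)), k.succ)) (fun _ : Fin K => Equiv.refl S) x y
              + (1 - t) * prodKernel (fun k : Fin (K + 1) => if k = 0 then (1 : ℝ) else 0) M x y)
      ∧ ∀ k : Fin K, μ k.succ u₀ ≤ 1 / 2 →
        spectralGap (tensorFun μ) (fun x y : Fin (K + 1) → S =>
            t * ptGraphSwap μ (fun k : Fin K => ((0 : Fin (K + 1)), k.succ)) (fun _ : Fin K => Equiv.refl S) x y
              + (1 - t) * prodKernel (fun k : Fin (K + 1) => if k = 0 then (1 : ℝ) else 0) M x y)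
          ≤ 2 * t * ((∑ y, w y * exp (β k.succ * X y)) / ∑ y, w y * exp (β 0 * X y)) / K := by
  have hpos : ∀ l y, 0 < μ l y := fun l y => expFamily_pos hw hμZ l y
  haveI : Nonempty S := ⟨u₀⟩
  have hZ0 := expFamily_Z_pos (β := β) (X := X) hw 0
  -- `p·μ_{k+1}(u₀) ≤ μ_0(u₀)` from `p·Z_0 ≤ Z_{k+1}` and the ratio identity
  have hpu : ∀ k : Fin K, p * μ k.succ u₀ ≤ μ 0 u₀ := by
    intro k
    have hZk := expFamily_Z_pos (β := β) (X := X) hw k.succ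
    have hr := expFamily_groundStateRatio_eq hw hμZ hX0 k.succ
    have hple : p ≤ μ 0 u₀ / μ k.succ u₀ := by
      rw [hr, le_div_iff₀ hZ0]; exact hpZ k
    rw [le_div_iff₀ (hpos _ _)] at hple
    exact hple
  obtain ⟨h1, h2⟩ := boltzmannHub_spectralGap_two_sided hw hμZ hK hX hβ hM hMrev ht0 ht1 hp hp1 hγ₀ hpu hgap0
  refine ⟨h1, fun k hk => ?_⟩
  rw [← expFamily_groundStateRatio_eq hw hμZ hX0 k.succ]
  exact h2 k hk

end Boltzmann

end Summit.Ventures.LatticeQCDFlow.Scaling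

end
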